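import Literature.Computability.Complexity.GateEliminationCase81
import Literature.Computability.Complexity.GateEliminationRule4Sharp

/-!
# Gate elimination: Case 8.1 of Li–Yang's proof of Theorem 4.1, dispatched under the standing assumptions

`case8_1`: under the standing assumptions of §4.1 after Case 4 (`Semicircuit.Standing`:
normalized, non-degenerate, no troubled pair, no configuration of Cases 1–4), let `G` be an
∧-type gate reading at position `aQ` a gate `Q` of the cyclic xor-part that depends on an
unprotected variable `x` (Case 8.1 of ECCC TR21-023, §4.1: "`Q` computes an affine function
depending on some unprotected variable `x`"). Then the one-step claim holds in its second branch
(`StepBranch2`, one substitution) in each of the printed sub-cases: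

* `Q` is a `2⁺`-gate — Case 8.1.1 (`case8_1_1`);
* the other wire of `G` is a variable `t` — then `t` is unprotected (Case 1), `G` is not the
  output (an ∧-type output gate reads no variable), `fanout(t) ≤ 2` (Case 3); a `2`-variable is
  Case 7 (`case7`, `Q` being then a `1`-gate whose uselessness and that of `G` are excluded by
  normalization), a `1`-variable is Case 8.1.2 (`case8_1_2`);
* the other wire of `G` is a `1`-gate of the xor-part — Case 8.1.3 (`case8_1_3`).

(When the other wire is a `2⁺`-gate `P` and `Q` is a `1`-gate, the paper exchanges `P` and `Q`
— "we further assume that the out-degree of `P` is not larger than `Q`" — and is in Case 8.1.1 if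
`P` depends on an unprotected variable, in Case 8.2 otherwise.) Also proved: in a non-degenerate
pre-normalized fair semicircuit no gate of the xor-part reads itself (`not_reads_self_of_standing`).

## References

* J. Li, T. Yang, *3.1n − o(n) circuit lower bounds for explicit functions*, STOC 2022;
  ECCC TR21-023, §4.1 (Case 7, Case 8, Case 8.1).
-/

namespace Literature.Computability.Complexity

open Finset

namespace Semicircuit

variable {n : ℕ} {C : Semicircuit n} {f : (Fin n → ZMod 2) → Bool} {R : RdqSource n} {d : ℕ}
  {αφ αI αQ : ℝ} {P : Finset (Fin C.m × Fin C.m)}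

/-- With no coinciding wires, the unique wire into a node of out-degree `1` determines its reader.
[folklore] -/
theorem eq_of_arg_eq_of_fanout_eq_one {D : Semicircuit n} (hN : ∀ k, D.arg k 0 ≠ D.arg k 1) {v : Node n D.m}
    (h1 : D.fanout v = 1) {k k' : Fin D.m} {a a' : Fin 2} (hk : D.arg k a = v) (hk' : D.arg k' a' = v) : k = k' := by
  classical
  rw [D.fanout_eq_card_readers hN v] at h1
  obtain ⟨k₀, hk₀⟩ := card_eq_one.mp h1
  have h₁ : k ∈ ({k₀} : Finset (Fin D.m)) := hk₀ ▸ mem_filter.mpr ⟨mem_univ _, a, hk⟩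
  have h₂ : k' ∈ ({k₀} : Finset (Fin D.m)) := hk₀ ▸ mem_filter.mpr ⟨mem_univ _, a', hk'⟩
  rw [mem_singleton] at h₁ h₂
  rw [h₁, h₂]

/-- **No gate of the xor-part reads itself** in a fair, pre-normalized, non-degenerate semicircuit:
the other input of `G = G ⊕ T ⊕ c` would be a constant (excluded), a variable (unfair) or a gate
computing the constant `c` (degenerate). [cite: LiYang2022, §4.1 (Case 0.3)] -/
theorem not_reads_self_of_standing (hF : C.Fair) (hN : C.PreNormalized) (hND : C.NonDegenerate)
    (Q : Fin C.m) : ∀ a, C.arg Q a ≠ .gate Q := by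
  intro a ha
  have hQK : Q ∈ C.xorPart := by
    by_contra h; exact C.arg_ne_self_of_not_mem h a ha
  obtain ⟨c, hc⟩ := C.isXorOp_of_mem Q hQK
  cases hT : C.arg Q a.rev with
  | const b' => exact hN.arg_ne_const Q a.rev b' hT
  | var i => exact hF.not_reads_self_of_var hT a ha
  | gate k =>
    -- the gate `k` computes the constant `c`
    refine hND k 0 (C.depOnlyOn_of_const (b := c) (fun x w hw => ?_) 0)
    have hQ := hw Q
    rw [hc] at hQ
    obtain rfl | rfl : a = 0 ∨ a = 1 := by fin_cases a <;> simp
    · have hT' : C.arg Q 1 = .gate k := hT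
      rw [ha, hT'] at hQ
      change w Q = ((w Q ^^ w k) ^^ c) at hQ
      revert hQ; cases w Q <;> cases w k <;> cases c <;> decide
    · have hT' : C.arg Q 0 = .gate k := hT
      rw [ha, hT'] at hQ
      change w Q = ((w k ^^ w Q) ^^ c) at hQ
      revert hQ; cases w Q <;> cases w k <;> cases c <;> decide

/-- **Case 8.1 of Li–Yang's proof of Theorem 4.1, under the standing assumptions**: `G` an ∧-type
gate reading at `aQ` a gate `Q` of the xor-part that depends on the unprotected variable `x`; if
`Q` is a `2⁺`-gate, or the other wire of `G` is a variable, or the other wire of `G` is a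
`1`-gate of the xor-part, then `1 ≤ t ≤ 3` substitutions with `Δμ ≥ δ t` are available (in fact
one). [cite: LiYang2022, §4.1 (Case 8.1, Case 7)] -/
theorem case8_1 (hf : IsAffineDisperser f d) (hd : 2 * d + 2 < R.dim) (hF : C.Fair)
    (hC : C.ComputesRestr f R) (hP : C.IsPacking P) (hφ : 0 ≤ αφ) (hφ1 : αφ ≤ 1) (hI : 0 ≤ αI) (αQ : ℝ)
    (hS : C.Standing R)
    {G Q : Fin C.m} {aQ : Fin 2} (hand : IsAndOp (C.op G)) (hGQ : C.arg G aQ = .gate Q) (hQK : Q ∈ C.xorPart)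
    {x : Fin n} (hdep : C.DependsOn hF Q x) (hxp : ¬ R.Protected x)
    (hshape : 2 ≤ C.fanout (.gate Q) ∨ (∃ t, C.arg G aQ.rev = .var t) ∨
      ∃ Pg, C.arg G aQ.rev = .gate Pg ∧ Pg ∈ C.xorPart ∧ C.fanout (.gate Pg) = 1) :
    C.StepBranch2 f R αφ αI αQ P := by
  classical
  have hN : C.PreNormalized := hS.normalized.1
  have hnu : ∀ G, ¬ C.Useless G := hS.normalized.2
  have hQself : ∀ a, C.arg Q a ≠ .gate Q := not_reads_self_of_standing hF hN hS.nonDegenerate Q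
  obtain ⟨p⟩ := C.exists_xorPath hF hQK hdep
  have hGK : G ∉ C.xorPart := C.not_mem_xorPart_of_isAndOp hand
  have hGQne : G ≠ Q := fun e => hGK (e ▸ hQK)
  -- Case 8.1.1 whenever `Q` is a `2⁺`-gate
  by_cases hQ2 : 2 ≤ C.fanout (.gate Q)
  · exact case8_1_1 hf hd hF hC hP hφ hI αQ hN hand hGQ (hnu G) p hdep hxp hQ2 hQself
  have hQ1 : C.fanout (.gate Q) = 1 := by
    have := fanout_pos_of_arg_eq hGQ; omega
  rcases hshape with h2 | ⟨t, hGt⟩ | ⟨Pg, hGP, hPK, hP1⟩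
  · exact absurd h2 hQ2
  · -- the other wire is a variable `t`: unprotected, a `1`- or `2`-variable
    have htp : ¬ R.Protected t := fun h => hS.protected_not_and t h G aQ.rev hGt hand
    have hGout : C.out ≠ .gate G := fun h => false_of_and_out_reads_var hf (by omega) hF hC h hand hGt
    obtain ⟨H, aH, hHG⟩ : ∃ (H : Fin C.m) (aH : Fin 2), C.arg H aH = .gate G := by
      by_contra hno
      push Not at hno
      exact hGout (hN.out_of_fanout_eq_zero G ((fanout_eq_zero_iff C _).mpr hno))
    have hG1 : 1 ≤ C.fanout (.gate G) := fanout_pos_of_arg_eq hHG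
    have ht3 := hS.and_fanout_le t G aQ.rev hGt hand
    have ht1 : 1 ≤ C.fanout (.var t) := fanout_pos_of_arg_eq hGt
    by_cases ht : C.fanout (.var t) = 1
    · -- Case 8.1.2: `t` is read only by `G`, hence `t ≠ x` (`x` is read by the first path gate)
      have htx : t ≠ x := by
        intro e
        have h0 : C.arg (p.gate 0) (p.pos 0) = .var t := by rw [e]; exact p.arg_zero
        exact p.gate_ne_of_isAndOp hand 0 (eq_of_arg_eq_of_fanout_eq_one hN.arg_zero_ne_arg_one ht h0 hGt)
      exact case8_1_2 hf hd hF hC hP hφ hφ1 hI αQ hand hGQ p hdep hxp hGt ht htp htx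
    · -- Case 7: `t` is a `2`-variable, `Q` a `1`-gate
      have ht2 : C.fanout (.var t) = 2 := by omega
      have hGfan : C.fanout (.gate G) = 1 := by omega
      obtain ⟨D, aD, hDG, hDt⟩ := exists_other_reader hN.arg_zero_ne_arg_one (le_of_eq ht2.symm) G
      -- the reader `H` of `G` does not read `t` (else `G` is useless)
      have hHGne : H ≠ G := fun e => C.arg_ne_self_of_not_mem hGK aH (e ▸ hHG)
      have hHt : ∀ a, C.arg H a ≠ .var t := by
        intro a ha
        refine hnu G ⟨hGfan, H, aH, aQ.rev, hHGne.symm, hHG, ?_⟩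
        have haa : a = aH.rev := by
          rcases fin2_eq_or_eq_rev aH a with e | e
          · rw [e, hHG] at ha; cases ha
          · exact e
        rw [← haa, ha, hGt]
      -- `Q` does not read `t` (else `Q` is useless)
      have hQt : ∀ a, C.arg Q a ≠ .var t := by
        intro a ha
        refine hnu Q ⟨hQ1, G, aQ, a, hGQne.symm, hGQ, ?_⟩
        rw [hGt, ha]
      have hQout : C.out ≠ .gate Q := out_ne_gate_of_mem_xorPart hf (by omega) hF hC hQK
      have hQand : ¬ IsAndOp (C.op Q) := not_isAndOp_of_isXorOp (C.isXorOp_of_mem Q hQK)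
      have hGQ' : C.arg G aQ.rev.rev = .gate Q := by rw [Fin.rev_rev]; exact hGQ
      exact case7 hf hd hF hC hP hφ hI αQ hand hGt hGQ' hQand htp hQ1 hQt hQout hDt hDG hHG hHt
  · exact case8_1_3 hf hd hF hC hP hφ hI αQ hN hand hGQ p hdep hxp hGP hPK hP1

end Semicircuit

end Literature.Computability.Complexity
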